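import Mathlib
import HarnessLib

/-!
# Polar coordinates on `ℝ³`: `∫ G = ∫_{S²} ∫_0^∞ G(rω) r² dr dσ(ω)`

(namespace `Literature.Analysis.Calculus`; used to integrate one-dimensional Hardy inequalities
(`RadialHardyTwoEdge.lean`) along the rays of `ℝ³`, as in Dafermos–Rodnianski–Shlapentokh-Rothman,
arXiv:1402.7034, §4.3, and Moschidis, arXiv:1509.08489, proof of Lemma 4.5)

Mathlib's `Measure.measurePreserving_homeomorphUnitSphereProd` identifies Lebesgue measure on
`ℝ³ ∖ {0}` with `σ ⊗ (r² dr)` on `S² × (0, ∞)`, `σ = volume.toSphere` (total mass `4π`). We record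
the resulting Tonelli formula for measurable `G : ℝ³ → [0, ∞]`:

* `lintegral_eq_lintegral_sphere_Ioi` — `∫⁻ x, G x = ∫⁻ ω ∂σ, ∫⁻ r ∈ (0,∞), G (r • ω) · r²`;
* `lintegral_radial_eq` — for radial integrands, `∫⁻ x, F ‖x‖ = σ(S²) · ∫⁻ r ∈ (0,∞), F r · r²`.

(The same computation appears, for the type synonym `Space` of the quantum many-body files, as
`Literature.MathematicalPhysics.QuantumManyBody.lintegral_eq_lintegral_sphere`; this file does not
import those files.) No definitions, no named facts. [folklore]

## References

* M. Dafermos, I. Rodnianski, Y. Shlapentokh-Rothman, arXiv:1402.7034, §4.3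
  (key `DafermosRodnianskiShlapentokhrothman2014`).
* G. Moschidis, arXiv:1509.08489, proof of Lemma 4.5 (key `Moschidis2016`).
-/

noncomputable section

open MeasureTheory Set Metric
open scoped ENNReal

namespace Literature.Analysis.Calculus

/-- **Polar coordinates on `ℝ³`**: `∫ G = ∫_{S²} dσ(ω) ∫_0^∞ G(rω) r² dr` for measurable
`G : ℝ³ → [0,∞]`, `σ = volume.toSphere`. [folklore] -/
theorem lintegral_eq_lintegral_sphere_Ioi (G : EuclideanSpace ℝ (Fin 3) → ℝ≥0∞)
    (hG : Measurable G) :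
    ∫⁻ x, G x = ∫⁻ ω : sphere (0 : EuclideanSpace ℝ (Fin 3)) 1,
      (∫⁻ r in Ioi (0 : ℝ), G (r • (ω : EuclideanSpace ℝ (Fin 3))) * ENNReal.ofReal (r ^ 2))
        ∂(volume : Measure (EuclideanSpace ℝ (Fin 3))).toSphere := by
  set e := homeomorphUnitSphereProd (EuclideanSpace ℝ (Fin 3)) with he
  have hmp := Measure.measurePreserving_homeomorphUnitSphereProd
    (volume : Measure (EuclideanSpace ℝ (Fin 3)))
  rw [finrank_euclideanSpace, Fintype.card_fin] at hmp
  calc ∫⁻ x, G x = ∫⁻ x in ({0}ᶜ : Set (EuclideanSpace ℝ (Fin 3))), G x := by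
        rw [restrict_compl_singleton]
    _ = ∫⁻ x : ({0}ᶜ : Set (EuclideanSpace ℝ (Fin 3))), G x ∂(volume.comap Subtype.val) :=
        (lintegral_subtype_comap (measurableSet_singleton (0 : EuclideanSpace ℝ (Fin 3))).compl G).symm
    _ = ∫⁻ x : ({0}ᶜ : Set (EuclideanSpace ℝ (Fin 3))), (G ∘ Subtype.val ∘ e.symm) (e x)
          ∂(volume.comap Subtype.val) := by
        simp
    _ = ∫⁻ q, (G ∘ Subtype.val ∘ e.symm) q
          ∂((volume : Measure (EuclideanSpace ℝ (Fin 3))).toSphere.prod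
            (Measure.volumeIoiPow (3 - 1))) :=
        hmp.lintegral_comp_emb e.measurableEmbedding _
    _ = ∫⁻ ω : sphere (0 : EuclideanSpace ℝ (Fin 3)) 1, (∫⁻ r : Ioi (0 : ℝ),
          G ((r : ℝ) • (ω : EuclideanSpace ℝ (Fin 3))) ∂(Measure.volumeIoiPow 2))
          ∂(volume : Measure (EuclideanSpace ℝ (Fin 3))).toSphere := by
        rw [lintegral_prod _ (Measurable.aemeasurable ?_)]
        · simp [he, homeomorphUnitSphereProd]
        · exact hG.comp (measurable_subtype_coe.comp e.symm.measurable)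
    _ = _ := by
        refine lintegral_congr fun ω ↦ ?_
        have hm : Measurable fun r : Ioi (0 : ℝ) ↦ G ((r : ℝ) • (ω : EuclideanSpace ℝ (Fin 3))) :=
          hG.comp (measurable_subtype_coe.smul_const _)
        rw [Measure.volumeIoiPow, lintegral_withDensity_eq_lintegral_mul _ (by fun_prop) hm,
          ← lintegral_subtype_comap measurableSet_Ioi
            (fun r : ℝ ↦ G (r • (ω : EuclideanSpace ℝ (Fin 3))) * ENNReal.ofReal (r ^ 2))]
        refine lintegral_congr fun r ↦ ?_
        simp [mul_comm]

/-- **Radial integrands**: `∫_{ℝ³} F(‖x‖) dx = σ(S²) ∫_0^∞ F(r) r² dr` (`σ(S²) = 4π`). [folklore] -/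
theorem lintegral_radial_eq (F : ℝ → ℝ≥0∞) (hF : Measurable F) :
    ∫⁻ x : EuclideanSpace ℝ (Fin 3), F ‖x‖ =
      (volume : Measure (EuclideanSpace ℝ (Fin 3))).toSphere univ *
        ∫⁻ r in Ioi (0 : ℝ), F r * ENNReal.ofReal (r ^ 2) := by
  rw [lintegral_eq_lintegral_sphere_Ioi (fun x ↦ F ‖x‖) (hF.comp measurable_norm)]
  have h : ∀ ω : sphere (0 : EuclideanSpace ℝ (Fin 3)) 1,
      (∫⁻ r in Ioi (0 : ℝ), F ‖r • (ω : EuclideanSpace ℝ (Fin 3))‖ * ENNReal.ofReal (r ^ 2)) =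
        ∫⁻ r in Ioi (0 : ℝ), F r * ENNReal.ofReal (r ^ 2) := by
    intro ω
    refine setLIntegral_congr_fun measurableSet_Ioi fun r hr ↦ ?_
    have : ‖r • (ω : EuclideanSpace ℝ (Fin 3))‖ = r := by
      rw [norm_smul, Real.norm_eq_abs, abs_of_pos hr, norm_eq_of_mem_sphere ω, mul_one]
    rw [this]
  simp_rw [h]
  rw [lintegral_const, mul_comm]

end Literature.Analysis.Calculus
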